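import Summits.PneNP.PneNP.Theorems.ExpanderLinearGeneratorsNoPolyBoundedProofSystem
import Literature.Computability.Complexity.ComplementTranslation

/-!
# Route ExpanderLinearGenerators — `NoPolyBoundedProofSystem` under the exponential-time and
# optimality hypotheses (`NE ≠ coNE`, `NEXP ≠ coNEXP`, "no optimal proof system")

Helper file for item `stmt-PneNP-0097` (the rank-0 target `NoPolyBoundedProofSystem := ¬
HasPolyBoundedProofSystem TAUT`, i.e. `NP ≠ coNP` by `noPolyBoundedProofSystem_iff_NP_ne_coNP`).
It places three classical hypotheses ABOVE the target, all kernel-checked over the tree's classes: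

* `noPolyBoundedProofSystem_of_co_NE_ne_NE`, `noPolyBoundedProofSystem_of_co_NEXP_ne_NEXP`:
  `NE ≠ coNE ⟹ X` and `NEXP ≠ coNEXP ⟹ X` — downward separation, i.e. the padding translation
  `NP = coNP ⟹ NE = coNE ⟹ NEXP = coNEXP` (`Literature/Computability/Complexity/ComplementTranslation.lean`,
  Book 1974's tally code and the polynomial pad) contraposed; with the converse bookkeeping
  `co_NE_eq_NE_of_not_noPolyBoundedProofSystem`, `co_NEXP_eq_NEXP_of_not_noPolyBoundedProofSystem`;
* `exists_optimal_of_hasPolyBoundedProofSystem`, `noPolyBoundedProofSystem_of_no_optimal`: a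
  polynomially bounded proof system for `TAUT` simulates every proof system for `TAUT`, so "there
  is no optimal proof system for `TAUT`" implies X (Krajíček 2019, §21.1: "If no optimal proof
  system exists then, of course, no proof system can be p-bounded and NP ≠ coNP"; by Cor. 21.1.3
  = Krajíček–Pudlák 1989 it even implies `NE ≠ coNE`);
* `no_pOptimal_of_no_optimal`: it also implies the crux `NoPOptimalTaut` of route Descriptive (no
  p-optimal proof system), since a p-simulation is a simulation (`PSimulates.simulates_holds`).

Sources: J. Krajíček, *Proof complexity* (CUP 2019), §21.1 and Cor. 21.1.3; J. Krajíček,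
P. Pudlák, JSL 54 (1989); R. V. Book, Information and Control 26 (1974); S. A. Cook,
R. A. Reckhow, JSL 44 (1979), §1.
-/

set_option linter.dupNamespace false -- `Summit.PneNP.PneNP.…`: summit = sub-problem name (D-0017 single-conjunct layout)

namespace Summit.PneNP.PneNP.Theorems

open Literature.Computability.Complexity Literature.Computability.MetaComplexity
open Summit.PneNP.PneNP.Theses.ExpanderLinearGenerators

/-! ### `NE ≠ coNE` and `NEXP ≠ coNEXP` imply the target -/

/-- **`NE ≠ coNE ⟹ NoPolyBoundedProofSystem`**: downward separation (`NP = coNP ⟹ NE = coNE`,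
`co_NE_eq_NE_of_NP_eq_coNP`) composed with `noPolyBoundedProofSystem_iff_NP_ne_coNP`.
[cite: KrajicekProofComplexity2019, §21.1 (before Cor. 21.1.3)] [cite: Book1974, Theorem 1 (p. 189)] -/
theorem noPolyBoundedProofSystem_of_co_NE_ne_NE (h : co NE ≠ NE) : NoPolyBoundedProofSystem :=
  noPolyBoundedProofSystem_iff_NP_ne_coNP.2 (NP_ne_coNP_of_co_NE_ne_NE h)

/-- **`NEXP ≠ coNEXP ⟹ NoPolyBoundedProofSystem`**: downward separation through `NE`
(`co_NEXP_eq_NEXP_of_NP_eq_coNP`). [cite: AroraBarak2009, §2.6.2 (Thm. 2.22, padding)]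
[cite: KrajicekProofComplexity2019, §21.1] -/
theorem noPolyBoundedProofSystem_of_co_NEXP_ne_NEXP (h : co NEXP ≠ NEXP) :
    NoPolyBoundedProofSystem :=
  noPolyBoundedProofSystem_iff_NP_ne_coNP.2 (NP_ne_coNP_of_co_NEXP_ne_NEXP h)

/-- Conversely put: the negation of the target (a polynomially bounded proof system for `TAUT`,
i.e. `NP = coNP`) collapses `NE` and `coNE`. [cite: KrajicekProofComplexity2019, §21.1 (before Cor. 21.1.3)] -/
theorem co_NE_eq_NE_of_not_noPolyBoundedProofSystem (h : ¬ NoPolyBoundedProofSystem) :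
    co NE = NE := by
  rw [noPolyBoundedProofSystem_iff_NP_ne_coNP, not_not] at h
  exact co_NE_eq_NE_of_NP_eq_coNP h

/-- … and collapses `NEXP` and `coNEXP`. [cite: AroraBarak2009, §2.6.2 (Thm. 2.22, padding)] -/
theorem co_NEXP_eq_NEXP_of_not_noPolyBoundedProofSystem (h : ¬ NoPolyBoundedProofSystem) :
    co NEXP = NEXP := by
  rw [noPolyBoundedProofSystem_iff_NP_ne_coNP, not_not] at h
  exact co_NEXP_eq_NEXP_of_NP_eq_coNP h

/-! ### Optimal proof systems -/

/-- **A polynomially bounded proof system for `TAUT` is optimal**: it simulates every proof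
system for `TAUT` (a `W`-proof of `x` shows `x ∈ TAUT`, which has a `V`-proof of length
`≤ p(|x|) ≤ p(|x| + |π|)`). Hence `¬X` yields an optimal proof system.
[cite: KrajicekProofComplexity2019, §21.1 (before Cor. 21.1.3)] [cite: CookReckhow1979, §1] -/
theorem exists_optimal_of_hasPolyBoundedProofSystem (h : HasPolyBoundedProofSystem TAUT) :
    ∃ V : List Bool → List Bool → Bool, IsProofSystemFor V TAUT ∧
      ∀ W : List Bool → List Bool → Bool, IsProofSystemFor W TAUT → Simulates V W := by
  obtain ⟨V, hV, p, hp⟩ := h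
  refine ⟨V, hV, fun W hW => ⟨p, fun x π hπ => ?_⟩⟩
  obtain ⟨π₀, hπ₀⟩ := (hV.mem_iff x).1 (hW.mem_of_eq_true hπ)
  obtain ⟨π', hlen, hπ'⟩ := hp x π₀ hπ₀
  exact ⟨π', hlen.trans (TM2Iter.eval_mono p (Nat.le_add_right _ _)), hπ'⟩

/-- **"No optimal proof system for `TAUT`" implies the target** `NoPolyBoundedProofSystem`
(Krajíček 2019, §21.1: "If no optimal proof system exists then, of course, no proof system can
be p-bounded and NP ≠ coNP"). [cite: KrajicekProofComplexity2019, §21.1 (before Cor. 21.1.3)] -/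
theorem noPolyBoundedProofSystem_of_no_optimal
    (h : ¬ ∃ V : List Bool → List Bool → Bool, IsProofSystemFor V TAUT ∧
      ∀ W : List Bool → List Bool → Bool, IsProofSystemFor W TAUT → Simulates V W) :
    NoPolyBoundedProofSystem := by
  unfold NoPolyBoundedProofSystem
  exact fun hX => h (exists_optimal_of_hasPolyBoundedProofSystem hX)

/-- A p-optimal proof system is optimal (a p-simulation is a simulation,
`PSimulates.simulates_holds`). [cite: KrajicekProofComplexity2019, Def. 1.1.4 and §21.1] -/
theorem exists_optimal_of_exists_pOptimal
    (h : ∃ V : List Bool → List Bool → Bool, IsProofSystemFor V TAUT ∧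
      ∀ W : List Bool → List Bool → Bool, IsProofSystemFor W TAUT → PSimulates V W) :
    ∃ V : List Bool → List Bool → Bool, IsProofSystemFor V TAUT ∧
      ∀ W : List Bool → List Bool → Bool, IsProofSystemFor W TAUT → Simulates V W := by
  obtain ⟨V, hV, hopt⟩ := h
  exact ⟨V, hV, fun W hW => PSimulates.simulates_holds (hopt W hW)⟩

/-- **"No optimal proof system" implies "no p-optimal proof system"** — the crux
`Summit.PneNP.PneNP.Theses.Descriptive.NoPOptimalTaut` of route Descriptive, spelled out (so the
optimality hypothesis sits above BOTH ladders: above X here, above `NoPOptimalTaut` there).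
[cite: KrajicekProofComplexity2019, §21.1 (Cor. 21.1.3 and Lemma 21.1.4)] -/
theorem no_pOptimal_of_no_optimal
    (h : ¬ ∃ V : List Bool → List Bool → Bool, IsProofSystemFor V TAUT ∧
      ∀ W : List Bool → List Bool → Bool, IsProofSystemFor W TAUT → Simulates V W) :
    ¬ ∃ V : List Bool → List Bool → Bool, IsProofSystemFor V TAUT ∧
      ∀ W : List Bool → List Bool → Bool, IsProofSystemFor W TAUT → PSimulates V W :=
  fun hp => h (exists_optimal_of_exists_pOptimal hp)

end Summit.PneNP.PneNP.Theorems
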